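import Mathlib
import Summits.AtomisticToContinuum.Crystallization.Theses.PhononSlackCertificates
import Summits.AtomisticToContinuum.Crystallization.Theorems.PhononSlackCertificatesNearFarGlueRPeriodicInsertion
import Summits.AtomisticToContinuum.Crystallization.Theorems.PhononSlackCertificatesNearFarGlueRHcpBoxSubset
import Summits.AtomisticToContinuum.Crystallization.Theorems.ChargedEnergyGap.Negative.BlocksBound
import Literature.MathematicalPhysics.StatisticalMechanics.PeriodicConfigurationSums

/-!
# Crux `PhononSlackCertificates.NearFarGlueR` (stmt-AtomisticToContinuum-14970), line `Sketch`:
the HOLE species in the REPAIR form — cone-free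

Continuation lead c5 (after wave 3).  In the torus / repair form of the residual
(`…NearFarGlueRTorus.lean`) a tight contact is repaired by exhibiting a better periodic
configuration.  With the periodic insertion identity (`stub_periodicInsertion`,
`…NearFarGlueRPeriodicInsertion.lean`) the simplest repair — FILLING A HOLE, one point per cell —
is priced exactly: `(n+1)·e(P ⊕ p) ≤ n·e(P) + W_p(P)` as soon as the non-zero periods have
length `≥ 9/10` (so the new point attracts its own translates), hence
`e(P ⊕ p) ≤ e(P) − (e(P) − W_p(P))/(n+1)`: a hole binding a test particle by MORE THAN THE
CURRENT ENERGY PER PARTICLE `e(P)` is a profitable repair (this file proves the several-holes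
version directly).  In the finite setting (c4,
`holes_gap`) the threshold was the certified lower cone `−0.7865`; on the torus it is the explicit
`e(P)` (`≈ −0.72` for near-optimal `P`) — no stability constant is involved.

* `card_motif_near_orbit_le` — periodic fibre count: motif points with a translate of `p`
  within `R` number `≤ (2R/δ+1)³` (`δ`-separated point set);
* `tsum_points_le_of_subset`, `exists_multi_insert`, `torusTight_ineq_holes` (= registered
  sub-goal `stub_torusHoles`; `stub_torusHole` is the one-hole case): several holes per cell
  (clearance `ρ`, pairwise `≥ 9/10` apart including translates) are filled one orbit at a time,
  `(n+s)·e ≤ n·e(P) + Σ_{p∈S} W_p(P)`; hence, if every tight motif point has a translate of some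
  hole within `R`, `e* + (G/(2(2R/δ+1)³))·#T/#motif ≤ e(P)` — the torus inequality of the
  residual for configurations whose tight contacts surround deep holes (vacancies, divacancies,
  vacancy superlattices in ANY matrix, relaxed or not), threshold `e(P)`, no cone.

All `[folklore]`.
-/

noncomputable section

namespace Summit.AtomisticToContinuum.Crystallization.Theorems.PhononSlackCertificatesNearFarGlueR

open Literature.MathematicalPhysics.StatisticalMechanics
open Literature.Geometry.DiscreteGeometry
open Summit.AtomisticToContinuum.Crystallization.Theses.PhononSlackCertificates
open scoped BigOperators Classical

/-! ## §1 Inserting one point per cell -/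

/-- **Monotonicity of the binding sum**: if `P.points ⊆ Q.points` and the extra points of `Q`
are all at distance `≥ 9/10` from `a`, then `W_a(Q) ≤ W_a(P)` (split the absolutely convergent
sum over `Q.points` into the `P.points` part and a non-positive remainder). [folklore] -/
theorem tsum_points_le_of_subset (P Q : PeriodicConfiguration 3) (a : EuclideanSpace ℝ (Fin 3))
    (hsub : P.points ⊆ Q.points)
    (hfar : ∀ q ∈ Q.points, q ∉ P.points → (9 / 10 : ℝ) ≤ dist a q) :
    (∑' q : {q : EuclideanSpace ℝ (Fin 3) // q ∈ Q.points ∧ q ≠ a}, lennardJones (dist a q.1)) ≤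
      ∑' q : {q : EuclideanSpace ℝ (Fin 3) // q ∈ P.points ∧ q ≠ a}, lennardJones (dist a q.1) := by
  have hsum := Q.summable_lennardJones_dist_three a
  set f : {q : EuclideanSpace ℝ (Fin 3) // q ∈ Q.points ∧ q ≠ a} → ℝ :=
    fun q => lennardJones (dist a q.1) with hf
  set s : Set {q : EuclideanSpace ℝ (Fin 3) // q ∈ Q.points ∧ q ≠ a} := {q | q.1 ∈ P.points} with hs
  have hsplit := hsum.tsum_subtype_add_tsum_subtype_compl s
  -- the complement is nonpositive
  have hneg : (∑' q : ↥sᶜ, f q) ≤ 0 :=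
    tsum_nonpos fun q => lennardJones_nonpos_of_ge_nine_tenths (hfar q.1.1 q.1.2.1 q.2)
  -- the `s`-part is the `P`-sum, by reindexing
  let e : ↥s ≃ {q : EuclideanSpace ℝ (Fin 3) // q ∈ P.points ∧ q ≠ a} :=
    { toFun := fun q => ⟨q.1.1, q.2, q.1.2.2⟩
      invFun := fun q => ⟨⟨q.1, hsub q.2.1, q.2.2⟩, q.2.1⟩
      left_inv := fun q => by ext; rfl
      right_inv := fun q => by ext; rfl }
  have hreidx : (∑' q : ↥s, f q) =
      ∑' q : {q : EuclideanSpace ℝ (Fin 3) // q ∈ P.points ∧ q ≠ a}, lennardJones (dist a q.1) := by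
    rw [← Equiv.tsum_eq e.symm]
    rfl
  have htot : (∑' q, f q) = (∑' q : ↥s, f q) + ∑' q : ↥sᶜ, f q := hsplit.symm
  calc (∑' q : {q : EuclideanSpace ℝ (Fin 3) // q ∈ Q.points ∧ q ≠ a}, lennardJones (dist a q.1))
      = ∑' q, f q := rfl
    _ = (∑' q : ↥s, f q) + ∑' q : ↥sᶜ, f q := htot
    _ ≤ (∑' q : ↥s, f q) + 0 := by linarith
    _ = _ := by rw [add_zero, hreidx]




/-- A point with positive clearance from the point set is off the point set. [folklore] -/
theorem not_mem_points_of_clearance (P : PeriodicConfiguration 3) {p : EuclideanSpace ℝ (Fin 3)}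
    {ρ : ℝ} (hρ : 0 < ρ) (hclear : ∀ q ∈ P.points, ρ ≤ dist p q) : p ∉ P.points := fun h => by
  have := hclear p h
  rw [dist_self] at this
  linarith

/-- The new point attracts its own translates: `Σ'_{g ≠ 0} V(‖g‖) ≤ 0` when all non-zero periods
have length `≥ 9/10`. [folklore] -/
theorem tsum_lattice_nonpos (P : PeriodicConfiguration 3)
    (hper : ∀ g ∈ P.lattice, g ≠ 0 → (9 / 10 : ℝ) ≤ ‖g‖) :
    (∑' g : {g : EuclideanSpace ℝ (Fin 3) // g ∈ P.lattice ∧ g ≠ 0}, lennardJones ‖g.1‖) ≤ 0 :=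
  tsum_nonpos fun g => lennardJones_nonpos_of_ge_nine_tenths (hper g.1 g.2.1 g.2.2)

/-! ## §2 The periodic fibre count -/

/-- **Periodic fibre count.**  In a periodic configuration with `δ`-separated point set, the motif
points having SOME translate of `p` within `R` number at most `(2R/δ + 1)³`: translate each
such motif point back by its period into the ball of radius `R` about `p` (injective by
`eq_of_sub_mem`) and pack. [folklore] -/
theorem card_motif_near_orbit_le (P : PeriodicConfiguration 3) {δ R : ℝ} (hδ : 0 < δ) (hR : 0 ≤ R)
    (hsep : ∀ u ∈ P.points, ∀ v ∈ P.points, u ≠ v → δ ≤ dist u v) (p : EuclideanSpace ℝ (Fin 3)) :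
    (((P.motif.filter fun y => ∃ g ∈ P.lattice, dist y (p + g) ≤ R)).card : ℝ) ≤
      (2 * R / δ + 1) ^ 3 := by
  set S := P.motif.filter fun y => ∃ g ∈ P.lattice, dist y (p + g) ≤ R with hS
  -- choose the period for each point of `S`
  have hch : ∀ y ∈ S, ∃ g ∈ P.lattice, dist y (p + g) ≤ R := fun y hy => (Finset.mem_filter.1 hy).2
  choose! gsel hgsel using hch
  -- the translated points
  set f : EuclideanSpace ℝ (Fin 3) → EuclideanSpace ℝ (Fin 3) := fun y => y - gsel y with hf
  have hinj : Set.InjOn f ↑S := by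
    intro y hy y' hy' hyy'
    simp only [hf] at hyy'
    have hmem : y - y' ∈ P.lattice := by
      have : y - y' = gsel y - gsel y' := sub_eq_sub_iff_sub_eq_sub.1 hyy'
      rw [this]
      exact P.lattice.sub_mem (hgsel y hy).1 (hgsel y' hy').1
    exact P.eq_of_sub_mem y (Finset.mem_filter.1 hy).1 y' (Finset.mem_filter.1 hy').1 hmem
  have hcard : (S.image f).card = S.card := Finset.card_image_of_injOn hinj
  have himg_pts : ∀ c ∈ S.image f, c ∈ P.points := by
    intro c hc
    obtain ⟨y, hy, rfl⟩ := Finset.mem_image.1 hc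
    have := P.add_mem_points (P.mem_points_of_mem_motif (Finset.mem_filter.1 hy).1)
      (P.lattice.neg_mem (hgsel y hy).1)
    simpa [hf, sub_eq_add_neg] using this
  have hball : ∀ c ∈ S.image f, dist c p ≤ R := by
    intro c hc
    obtain ⟨y, hy, rfl⟩ := Finset.mem_image.1 hc
    have h := (hgsel y hy).2
    simp only [hf]
    rw [dist_eq_norm] at h ⊢
    have : y - gsel y - p = y - (p + gsel y) := by abel
    rw [this]
    exact h
  have hsepS : ∀ c ∈ S.image f, ∀ d ∈ S.image f, c ≠ d → δ ≤ dist c d := fun c hc d hd hcd =>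
    hsep c (himg_pts c hc) d (himg_pts d hd) hcd
  have key := card_le_of_separated_of_dist_le (S.image f) p hδ hR hball hsepS
  rw [finrank_euclideanSpace_fin, hcard] at key
  exact key

/-! ## §3 Several holes per cell -/

/-- **Multi-insertion.**  Inserting a finite set `S` of holes (clearance `ρ` from `P.points`,
pairwise `≥ 9/10` apart including translates, periods `≥ 9/10`) one orbit at a time:
there is a configuration `Q` with motif `P.motif ∪ S`, points `P.points ∪ (S + periods)`, and
`(n + #S)·e(Q) ≤ n·e(P) + Σ_{p ∈ S} W_p(P)` (induction on `S`: the insertion identity, the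
translates' sum `≤ 0`, and `W_a` relative to the current configuration `≤ W_a(P)` by
`tsum_points_le_of_subset`). [folklore] -/
theorem exists_multi_insert (P : PeriodicConfiguration 3) (S : Finset (EuclideanSpace ℝ (Fin 3)))
    {ρ : ℝ} (hρ : 0 < ρ) (hclear : ∀ p ∈ S, ∀ q ∈ P.points, ρ ≤ dist p q)
    (hsepS : ∀ p ∈ S, ∀ p' ∈ S, ∀ g ∈ P.lattice, (p ≠ p' ∨ g ≠ 0) → (9 / 10 : ℝ) ≤ dist p (p' + g))
    (hper : ∀ g ∈ P.lattice, g ≠ 0 → (9 / 10 : ℝ) ≤ ‖g‖) :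
    ∃ Q : PeriodicConfiguration 3, Q.motif = P.motif ∪ S ∧
      (∀ g : EuclideanSpace ℝ (Fin 3), g ∈ Q.lattice ↔ g ∈ P.lattice) ∧
      (∀ q : EuclideanSpace ℝ (Fin 3), q ∈ Q.points ↔
        (q ∈ P.points ∨ ∃ p ∈ S, ∃ g ∈ P.lattice, q = p + g)) ∧
      ((P.motif.card : ℝ) + S.card) * Q.energyPerParticle lennardJones ≤
        (P.motif.card : ℝ) * P.energyPerParticle lennardJones +
          ∑ p ∈ S, ∑' q : {q : EuclideanSpace ℝ (Fin 3) // q ∈ P.points ∧ q ≠ p},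
            lennardJones (dist p q.1) := by
  induction S using Finset.induction_on with
  | empty =>
    refine ⟨P, by simp, fun g => Iff.rfl, fun q => ?_, by simp⟩
    simp
  | @insert a S haS ih =>
    -- hypotheses for `S`
    obtain ⟨QS, hQSm, hQSl, hQSp, hQSe⟩ :=
      ih (fun p hp => hclear p (Finset.mem_insert_of_mem hp))
        (fun p hp p' hp' => hsepS p (Finset.mem_insert_of_mem hp) p' (Finset.mem_insert_of_mem hp'))
    have ha : a ∈ insert a S := Finset.mem_insert_self a S
    -- clearance of `a` from `QS.points`
    set ρ' : ℝ := min ρ (9 / 10) with hρ'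
    have hρ'0 : 0 < ρ' := lt_min hρ (by norm_num)
    have hclearQS : ∀ q ∈ QS.points, ρ' ≤ dist a q := by
      intro q hq
      rcases (hQSp q).1 hq with hqP | ⟨p, hp, g, hg, rfl⟩
      · exact (min_le_left _ _).trans (hclear a ha q hqP)
      · have hne : a ≠ p := fun h => haS (h ▸ hp)
        exact (min_le_right _ _).trans
          (hsepS a ha p (Finset.mem_insert_of_mem hp) g hg (Or.inl hne))
    have haQS : a ∉ QS.points := fun h => by
      have := hclearQS a h
      rw [dist_self] at this
      linarith
    have hineq : ∀ y ∈ QS.motif, a - y ∉ QS.lattice := by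
      intro y hy hmem
      exact haQS ⟨y, hy, a - y, hmem, by abel⟩
    obtain ⟨Q, hQm, hQl, hQp⟩ := exists_insert_periodicConfiguration QS a hineq
    -- the identity for `(QS, Q, a)`
    have hQp' : ∀ q : EuclideanSpace ℝ (Fin 3), q ∈ Q.points ↔
        (q ∈ QS.points ∨ ∃ g ∈ QS.lattice, q = a + g) := hQp
    have hId := stub_periodicInsertion QS Q a ρ' hρ'0 hclearQS hQm hQp'
    -- the translates' sum is `≤ 0`
    have hT : (∑' g : {g : EuclideanSpace ℝ (Fin 3) // g ∈ QS.lattice ∧ g ≠ 0},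
        lennardJones ‖g.1‖) ≤ 0 :=
      tsum_nonpos fun g => lennardJones_nonpos_of_ge_nine_tenths
        (hper g.1 ((hQSl g.1).1 g.2.1) g.2.2)
    -- `W_a(QS) ≤ W_a(P)`
    have hW : (∑' q : {q : EuclideanSpace ℝ (Fin 3) // q ∈ QS.points ∧ q ≠ a},
        lennardJones (dist a q.1)) ≤
        ∑' q : {q : EuclideanSpace ℝ (Fin 3) // q ∈ P.points ∧ q ≠ a}, lennardJones (dist a q.1) := by
      refine tsum_points_le_of_subset P QS a (fun q hq => (hQSp q).2 (Or.inl hq)) ?_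
      intro q hq hqP
      rcases (hQSp q).1 hq with h | ⟨p, hp, g, hg, rfl⟩
      · exact absurd h hqP
      · have hne : a ≠ p := fun h => haS (h ▸ hp)
        exact hsepS a ha p (Finset.mem_insert_of_mem hp) g hg (Or.inl hne)
    -- cardinalities
    have hdisj : Disjoint P.motif S := by
      rw [Finset.disjoint_left]
      intro y hyP hyS
      have := hclear y (Finset.mem_insert_of_mem hyS) y (P.mem_points_of_mem_motif hyP)
      rw [dist_self] at this
      linarith
    have hcardQS : (QS.motif.card : ℝ) = P.motif.card + S.card := by
      rw [hQSm, Finset.card_union_of_disjoint hdisj]; push_cast; ring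
    refine ⟨Q, ?_, fun g => (hQl g).trans (hQSl g), fun q => ?_, ?_⟩
    · rw [hQm, hQSm, Finset.union_insert]
    · rw [hQp' q]
      constructor
      · rintro (hq | ⟨g, hg, rfl⟩)
        · rcases (hQSp q).1 hq with h | ⟨p, hp, g, hg, rfl⟩
          · exact Or.inl h
          · exact Or.inr ⟨p, Finset.mem_insert_of_mem hp, g, hg, rfl⟩
        · exact Or.inr ⟨a, ha, g, (hQSl g).1 hg, rfl⟩
      · rintro (hq | ⟨p, hp, g, hg, rfl⟩)
        · exact Or.inl ((hQSp q).2 (Or.inl hq))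
        · rcases Finset.mem_insert.1 hp with rfl | hp'
          · exact Or.inr ⟨g, (hQSl g).2 hg, rfl⟩
          · exact Or.inl ((hQSp _).2 (Or.inr ⟨p, hp', g, hg, rfl⟩))
    · rw [Finset.sum_insert haS, Finset.card_insert_of_notMem haS]
      push_cast
      rw [hcardQS] at hId
      nlinarith [hQSe, hId, hT, hW]

/-- **Deep holes pay for the tight contacts around them, CONE-FREE (torus form).**  Let `P`
have `δ`-separated point set and non-zero periods of length `≥ 9/10`; let `S` be a set of at
most `#motif` holes per cell with clearance `ρ > 0` from `P.points`, pairwise `≥ 9/10` apart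
including translates, each binding a test particle by more than the current energy per particle,
`W_p(P) ≤ e(P) − G`; if every tight motif point has a translate of some hole within `R`, then
`e* + (G/(2(2R/δ+1)³))·#T(motif)/#motif ≤ e(P)` — the torus inequality of the residual for
configurations whose tight contacts surround deep holes (vacancies, divacancies, vacancy
superlattices in ANY matrix, relaxed or not), with threshold `e(P)` and no stability constant.
[folklore] -/
theorem torusTight_ineq_holes (P : PeriodicConfiguration 3) (S : Finset (EuclideanSpace ℝ (Fin 3)))
    {δ ρ R G : ℝ} (hδ : 0 < δ) (hρ : 0 < ρ) (hR : 0 ≤ R) (hG : 0 ≤ G)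
    (hsep : ∀ u ∈ P.points, ∀ v ∈ P.points, u ≠ v → δ ≤ dist u v)
    (hclear : ∀ p ∈ S, ∀ q ∈ P.points, ρ ≤ dist p q)
    (hsepS : ∀ p ∈ S, ∀ p' ∈ S, ∀ g ∈ P.lattice, (p ≠ p' ∨ g ≠ 0) → (9 / 10 : ℝ) ≤ dist p (p' + g))
    (hper : ∀ g ∈ P.lattice, g ≠ 0 → (9 / 10 : ℝ) ≤ ‖g‖)
    (hW : ∀ p ∈ S, (∑' q : {q : EuclideanSpace ℝ (Fin 3) // q ∈ P.points ∧ q ≠ p},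
      lennardJones (dist p q.1)) ≤ P.energyPerParticle lennardJones - G)
    (hnear : ∀ y ∈ P.motif, (¬ IsTwoShellGoodSet (1 / 20) (47 / 50) 1 P.points y ∧
        ∃ z ∈ P.points, IsTwoShellGoodSet (1 / 20) (47 / 50) 1 P.points z ∧ dist z y ≤ 21 / 20) →
      ∃ p ∈ S, ∃ g ∈ P.lattice, dist y (p + g) ≤ R)
    (hS : S.card ≤ P.motif.card) :
    (⨅ Q : PeriodicConfiguration 3, Q.energyPerParticle lennardJones)
      + G / (2 * (2 * R / δ + 1) ^ 3) *
        ((P.motif.filter fun y => ¬ IsTwoShellGoodSet (1 / 20) (47 / 50) 1 P.points y ∧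
            ∃ z ∈ P.points, IsTwoShellGoodSet (1 / 20) (47 / 50) 1 P.points z ∧
              dist z y ≤ 21 / 20).card : ℝ) / (P.motif.card : ℝ)
      ≤ P.energyPerParticle lennardJones := by
  obtain ⟨Q, -, -, -, hQe⟩ := exists_multi_insert P S hρ hclear hsepS hper
  have hstar : (⨅ Q : PeriodicConfiguration 3, Q.energyPerParticle lennardJones) ≤
      Q.energyPerParticle lennardJones :=
    ciInf_le ChargedEnergyGapNegative.bddBelow_energyPerParticle_lennardJones Q
  set K : ℝ := (2 * R / δ + 1) ^ 3 with hK
  have hK1 : 1 ≤ K := by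
    have : (1 : ℝ) ≤ 2 * R / δ + 1 := by
      have : 0 ≤ 2 * R / δ := by positivity
      linarith
    exact one_le_pow₀ this
  have hKpos : 0 < K := by linarith
  set T := (P.motif.filter fun y => ¬ IsTwoShellGoodSet (1 / 20) (47 / 50) 1 P.points y ∧
      ∃ z ∈ P.points, IsTwoShellGoodSet (1 / 20) (47 / 50) 1 P.points z ∧
        dist z y ≤ 21 / 20) with hT
  set τ : ℝ := (T.card : ℝ) with hτ
  set n : ℝ := (P.motif.card : ℝ) with hn
  set s : ℝ := (S.card : ℝ) with hs
  have hn1 : 1 ≤ n := by rw [hn]; exact_mod_cast P.motif_nonempty.card_pos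
  have hsn : s ≤ n := by rw [hs, hn]; exact_mod_cast hS
  have hs0 : 0 ≤ s := by rw [hs]; positivity
  -- `τ ≤ K·s`
  have hτK : τ ≤ K * s := by
    have hcov : T ⊆ S.biUnion fun p => P.motif.filter fun y => ∃ g ∈ P.lattice, dist y (p + g) ≤ R := by
      intro y hy
      rw [Finset.mem_filter] at hy
      obtain ⟨p, hp, g, hg, hd⟩ := hnear y hy.1 hy.2
      exact Finset.mem_biUnion.2 ⟨p, hp, Finset.mem_filter.2 ⟨hy.1, g, hg, hd⟩⟩
    have h1 : (T.card : ℝ) ≤ ∑ p ∈ S,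
        ((P.motif.filter fun y => ∃ g ∈ P.lattice, dist y (p + g) ≤ R).card : ℝ) := by
      have := (Finset.card_le_card hcov).trans Finset.card_biUnion_le
      exact_mod_cast this
    have h2 : ∑ p ∈ S, ((P.motif.filter fun y => ∃ g ∈ P.lattice, dist y (p + g) ≤ R).card : ℝ) ≤
        ∑ _p ∈ S, K := Finset.sum_le_sum fun p _ => card_motif_near_orbit_le P hδ hR hsep p
    rw [Finset.sum_const, nsmul_eq_mul] at h2
    rw [hτ]
    nlinarith
  -- `Σ_{p∈S} W_p ≤ s (e − G)`
  have hWsum : ∑ p ∈ S, (∑' q : {q : EuclideanSpace ℝ (Fin 3) // q ∈ P.points ∧ q ≠ p},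
      lennardJones (dist p q.1)) ≤ s * (P.energyPerParticle lennardJones - G) := by
    have := Finset.sum_le_sum fun p hp => hW p hp
    rw [Finset.sum_const, nsmul_eq_mul] at this
    rw [hs]; exact this
  -- combine: (n+s) e(Q) ≤ (n+s) e − s G, so e − e(Q) ≥ sG/(n+s) ≥ sG/(2n) ≥ (G/(2K)) τ / n
  have hmain : (n + s) * Q.energyPerParticle lennardJones ≤
      (n + s) * P.energyPerParticle lennardJones - s * G := by
    nlinarith [hQe, hWsum]
  have hτ0 : 0 ≤ τ := by rw [hτ]; positivity
  have hgoal : G / (2 * K) * τ / n ≤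
      P.energyPerParticle lennardJones - Q.energyPerParticle lennardJones := by
    rw [div_le_iff₀ (by positivity)]
    -- G/(2K) τ ≤ (e − e_Q) n ; we know (n+s)(e − e_Q) ≥ sG and τ ≤ Ks, s ≤ n
    have h3 : G / (2 * K) * τ ≤ G / (2 * K) * (K * s) :=
      mul_le_mul_of_nonneg_left hτK (by positivity)
    have h4 : G / (2 * K) * (K * s) = G * s / 2 := by
      field_simp
    have h5 : s * G ≤ (n + s) * (P.energyPerParticle lennardJones - Q.energyPerParticle lennardJones) := by
      nlinarith
    have h6 : (n + s) * (P.energyPerParticle lennardJones - Q.energyPerParticle lennardJones) ≤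
        2 * n * (P.energyPerParticle lennardJones - Q.energyPerParticle lennardJones) := by
      have hd : 0 ≤ P.energyPerParticle lennardJones - Q.energyPerParticle lennardJones := by
        refine le_of_mul_le_mul_left ?_ (show (0 : ℝ) < n + s by positivity)
        rw [mul_zero]
        nlinarith
      nlinarith
    nlinarith
  linarith


/-- **Registered sub-goal `stub_torusHoles` of the line `Sketch`** (the several-holes torus
species in closed form). [folklore] -/
theorem stub_torusHoles :
    ∀ (P : PeriodicConfiguration 3) (S : Finset (EuclideanSpace ℝ (Fin 3))) (δ ρ R G : ℝ),
      0 < δ → 0 < ρ → 0 ≤ R → 0 ≤ G →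
      (∀ u ∈ P.points, ∀ v ∈ P.points, u ≠ v → δ ≤ dist u v) →
      (∀ p ∈ S, ∀ q ∈ P.points, ρ ≤ dist p q) →
      (∀ p ∈ S, ∀ p' ∈ S, ∀ g ∈ P.lattice, (p ≠ p' ∨ g ≠ 0) → (9 / 10 : ℝ) ≤ dist p (p' + g)) →
      (∀ g ∈ P.lattice, g ≠ 0 → (9 / 10 : ℝ) ≤ ‖g‖) →
      (∀ p ∈ S, (∑' q : {q : EuclideanSpace ℝ (Fin 3) // q ∈ P.points ∧ q ≠ p},
        lennardJones (dist p q.1)) ≤ P.energyPerParticle lennardJones - G) →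
      (∀ y ∈ P.motif, (¬ IsTwoShellGoodSet (1 / 20) (47 / 50) 1 P.points y ∧
          ∃ z ∈ P.points, IsTwoShellGoodSet (1 / 20) (47 / 50) 1 P.points z ∧ dist z y ≤ 21 / 20) →
        ∃ p ∈ S, ∃ g ∈ P.lattice, dist y (p + g) ≤ R) →
      S.card ≤ P.motif.card →
      (⨅ Q : PeriodicConfiguration 3, Q.energyPerParticle lennardJones)
        + G / (2 * (2 * R / δ + 1) ^ 3) *
          ((P.motif.filter fun y => ¬ IsTwoShellGoodSet (1 / 20) (47 / 50) 1 P.points y ∧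
              ∃ z ∈ P.points, IsTwoShellGoodSet (1 / 20) (47 / 50) 1 P.points z ∧
                dist z y ≤ 21 / 20).card : ℝ) / (P.motif.card : ℝ)
        ≤ P.energyPerParticle lennardJones :=
  fun P S _ _ _ _ hδ hρ hR hG hsep hclear hsepS hper hW hnear hS =>
    torusTight_ineq_holes P S hδ hρ hR hG hsep hclear hsepS hper hW hnear hS

/-- **Registered sub-goal `stub_torusHole` of the line `Sketch`** (the one-hole torus species in
closed form). [folklore] -/
theorem stub_torusHole :
    ∀ (P : PeriodicConfiguration 3) (p : EuclideanSpace ℝ (Fin 3)) (δ ρ R G : ℝ),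
      0 < δ → 0 < ρ → 0 ≤ R → 0 ≤ G →
      (∀ u ∈ P.points, ∀ v ∈ P.points, u ≠ v → δ ≤ dist u v) →
      (∀ q ∈ P.points, ρ ≤ dist p q) →
      (∀ g ∈ P.lattice, g ≠ 0 → (9 / 10 : ℝ) ≤ ‖g‖) →
      (∑' q : {q : EuclideanSpace ℝ (Fin 3) // q ∈ P.points ∧ q ≠ p}, lennardJones (dist p q.1)) ≤
        P.energyPerParticle lennardJones - G →
      (∀ y ∈ P.motif, (¬ IsTwoShellGoodSet (1 / 20) (47 / 50) 1 P.points y ∧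
          ∃ z ∈ P.points, IsTwoShellGoodSet (1 / 20) (47 / 50) 1 P.points z ∧ dist z y ≤ 21 / 20) →
        ∃ g ∈ P.lattice, dist y (p + g) ≤ R) →
      (⨅ Q : PeriodicConfiguration 3, Q.energyPerParticle lennardJones)
        + G / (2 * (2 * R / δ + 1) ^ 3) *
          ((P.motif.filter fun y => ¬ IsTwoShellGoodSet (1 / 20) (47 / 50) 1 P.points y ∧
              ∃ z ∈ P.points, IsTwoShellGoodSet (1 / 20) (47 / 50) 1 P.points z ∧
                dist z y ≤ 21 / 20).card : ℝ) / (P.motif.card : ℝ)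
        ≤ P.energyPerParticle lennardJones := by
  intro P p δ ρ R G hδ hρ hR hG hsep hclear hper hW hnear
  have h := torusTight_ineq_holes P {p} hδ hρ hR hG hsep (fun q hq => by
      rw [Finset.mem_singleton] at hq; subst hq; exact hclear)
    (fun q hq q' hq' g hg hne => by
      rw [Finset.mem_singleton] at hq hq'
      rw [hq, hq'] at hne ⊢
      rcases hne with h | h
      · exact absurd rfl h
      · rw [dist_eq_norm, show p - (p + g) = -g by abel, norm_neg]
        exact hper g hg h)
    hper (fun q hq => by rw [Finset.mem_singleton] at hq; subst hq; exact hW)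
    (fun y hy hT => by
      obtain ⟨g, hg, hd⟩ := hnear y hy hT
      exact ⟨p, Finset.mem_singleton_self p, g, hg, hd⟩)
    (by rw [Finset.card_singleton]; exact P.motif_nonempty.card_pos)
  exact h

end Summit.AtomisticToContinuum.Crystallization.Theorems.PhononSlackCertificatesNearFarGlueR

end
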